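import Summits.QuantumFields.YangMills.Theorems.UnitScaleTiltHalvingP1FlatCoreTopStep
import Literature.MathematicalPhysics.QuantumFieldTheory.Balaban1983to89.B8SectEKLevelFamilyHc
import HarnessLib

/-!
# `UnitScaleTiltHalvingP1FlatCoreTopStepFamily` — line H (`BirthV10.stub_halvingStep`, stmt-QuantumFields-19200), T2♭-PLAN v1.1 #46 §3 **J4c (T4), N05 side**:
# PROPOSITION 5's k-LEVEL STEP WITH A MIXED RESTRICTION FUNCTIONAL `Qfull = Qlin + Cfam` AND AN INHOMOGENEOUS TARGET `t̂` — the restriction-agnostic JOIN-B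
# (`HalvingP1FlatCoreTopStep.hFP_kLevel_ofConstraint_RD`, ✓p626260) instantiated at the Sect. E correction of an ABSTRACT remainder family with shifted base point
# (★w8-19936 s2's J4b `B8SectEKLevelFamilyHc.exists_Hc_of_family`): the fixed point `λ′` satisfies `Qfull j (−iλ′) y = t̂ (j, y)` on every index site of every level

WHY (cell `ym3-torus`; LEAD-H ★w5-19200 g4 RULING L-3 + T2♭-PLAN v1.1 J4; ★★OWNER ACK 45 (b); this seat's J4C-LOCATE = 19200 evidence #51; ★w8 s2's J4B-LOCATE #53).  The H-line's
top normalisation (o) of `core′` is, in Sect. E's variable `μ = −iλ′` of the inverse gauge `(e^{iλ′})⁻¹` (ORDER ruling (a″) of N05), an equation `Qfull k μ y = t̂ (k, y)` on the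
top index sites, where `Qfull k` = `log` of the effective top gauge map of the double-bar tower (✓`P1FlatCoreFrameLinTower`) splits as the LINEAR k-fold site average `Qlin k` plus a
small-Lipschitz remainder `Cfam k` (the tower induction), and `t̂ (k, ·) = −i·log (axialT W̿₁^{(k)} y₀ ·)` (LEAD-H L-3; ✓`P1FlatCoreDP1Target.dp1Clause_of_effGauge_eq_axialT`); below
the top `Qfull j` = print's axial functional `Q′_j(u₁⁻¹, ·)`, `Cfam j` = [3] (213)'s `C′_j`, `t̂ (j, ·) = 0` (print's (1.29)).  ★w8 s2's J4b supplies, for ANY such family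
`Cfam` with the (1.121)∕(1.125)∕reality rows and ANY skew target `t̂` with `B′₀‖t̂‖ < ¼α₄`, the affine correction `H_c λ = i(H′t̂ − H′D′(−iλ + H′t̂))` with EXACTLY the eight binders of
`hFP_kLevel_agnostic_RD` and the TRANSFER (1.117).  THIS FILE composes the two: ★★ `hFP_kLevel_family_RD` — under JOIN-B's [4] letters (RD form), (1.101)∕(1.98)R, the datum,
H′'s rows (1.92), the family's rows, the split `Qfull = Qlin + Cfam` with `Qlin` additive, `Qlin j (H′Y) y = Y (j, y)` and `Q′λ = 0 ⇒ Qlin j (−iλ) = 0` on the index sites, and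
JOIN-B's windows at the sizes `h₀ = h₁ = B′₀(Cb + ‖t̂‖)`, `h₂ = B′₂(Cb + ‖t̂‖)`, `l₀ = l₁ = 2B′₀Cl`, `l₂ = 2B′₂Cl`: ∃ `λ′` Hermitian, `= 0` off `Ω₀`, (1.108) on `Eb j`, the multiplier
form of the Landau equation on `Ω₀`, and **`Qfull j (−iλ′) y = t̂ (j, y)` for every `j ≤ k`, `y ∈ Λs j`**.  The torus dictionary ((o) ⟸ the `j = k` clause; (1.29) below the top
⟸ the `j < k` clauses) and the discharge of `Cfam k`'s rows by the tower induction are the next files (J4c (T4b), the induction hand LEAD-H names).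
HONEST FRAMING.  By-name composition of two landed theorems; the [4] letters, H′'s rows, the family's rows, the datum and every window stay DISPLAYED; nothing of [4], of [3]
Prop. 10, of Sect. E's estimates or of the tower induction is proved here.  Count-neutral helper (`--supports stmt-QuantumFields-19200 --as helper`, ★★OWNER-worded tag);
registry∕binders∕skeleton text untouched (J r4).  YM₃ on T³ = rung R3, NOT the Clay problem; nothing here proves `core′`, the stub, the crux or a mass gap.

References: T. Bałaban, Commun. Math. Phys. 99 (1985) 75–102 [Balaban1985RegularSpaces] (Prop. 5 (1.107)–(1.109) p.94, (1.95)–(1.106) pp.92–94, (1.113)–(1.117) pp.95–96,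
(1.92) p.91); Commun. Math. Phys. 98 (1985) 17–51 [Balaban1985Averaging] ((213)–(214) p.50).
-/

set_option autoImplicit false

noncomputable section

open NormedSpace Metric Set
open Complex (I)

namespace Summit.QuantumFields.YangMills.Theorems.HalvingP1FlatCoreTopStep

open Literature.MathematicalPhysics.QuantumFieldTheory.Balaban1983to89
open B7Prop1Explicit (e)
open B7Prop2Explicit (unitaryUnits)
open B7Eq78Linearization (conjR)
open B7Eq170Flat (cj)
open B7Prop1Local (InBox)
open B8Ineq130 (tlo thi)
open B8Ineq132 (covDerivFwd)
open B8Eq138LandauZd (covLap covDivB QT)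
open B8Eq182Proof (gAd)
open B8Eq184Proof (gaugeExp)
open B8Eq188Proof (frakF3)
open B8Eq1117Concrete (XSpace)
open B8LambdaSpaceKLevel (wt lamSubK lamOf)
open B8Prop5ContractionKLevel (Bd2 Mc Kc)
open B8SectEKLevelFamily (eq1114_of_fixedPoint_kLevel_fam)
open B8SectEKLevelFamilyHc (exists_Hc_of_family)

-- `Site` alone could resolve to the torus sites of `Setup.lean`; use the `ℤ^d` sites of `B7Prop1Explicit`.
open B7Prop1Explicit (Site)

variable {d : ℕ} {𝔸 : Type*} [CStarAlgebra 𝔸] [Nontrivial 𝔸]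

variable {L k : ℕ} {η : ℝ} {Ω Λs : ℕ → Set (Site d)} {Eb : ℕ → Set (Site d × Fin d)} {U₀ : Site d → Fin d → 𝔸ˣ}
  {A : Site d → Fin d → 𝔸}

omit [Nontrivial 𝔸] in
/-- `Qlin j` additive from the displayed subtraction law. [folklore] -/
theorem qlin_add_of_sub (Qlin : ℕ → (Site d → 𝔸) → Site d → 𝔸)
    (hlin : ∀ (j : ℕ) (μ₁ μ₂ : Site d → 𝔸) (y : Site d), Qlin j (μ₁ - μ₂) y = Qlin j μ₁ y - Qlin j μ₂ y)
    (j : ℕ) (μ₁ μ₂ : Site d → 𝔸) (y : Site d) : Qlin j (μ₁ + μ₂) y = Qlin j μ₁ y + Qlin j μ₂ y := by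
  have h := hlin j (μ₁ + μ₂) μ₂ y
  rw [add_sub_cancel_right] at h
  rw [← sub_eq_iff_eq_add]; exact h.symm

/-- ★★ **PROPOSITION 5's FIXED POINT WITH A MIXED RESTRICTION FUNCTIONAL AND AN INHOMOGENEOUS TARGET** — `hFP_kLevel_ofConstraint_RD` at the Sect. E correction
`H_c λ = i(H′t̂ − H′D′(−iλ + H′t̂))` of ★w8 s2's `exists_Hc_of_family`: for ANY remainder family `Cfam` (rows (1.121) `hC121`, (1.125) `hC125`, reality `hCreal` on the (1.120)-set of
every tower), ANY split `Qfull j = Qlin j + Cfam j` with `Qlin` additive, `Qlin j (H′Y) y = Y (j, y)` ((1.91)) and `Q′λ = 0 ⇒ Qlin j (−iλ) y = 0` on the index sites, and ANY skew target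
`t̂` with `B′₀‖t̂‖ < ¼α₄`, the Prop.-5 fixed point `λ′` (Hermitian, `= 0` off `Ω₀`, (1.108) on `Eb j`, multiplier form of the Landau equation on `Ω₀`) satisfies
`Qfull j (−iλ′) y = t̂ (j, y)` for all `j ≤ k`, `y ∈ Λs j`.  At `t̂ = 0`, `Qfull = Q′(u₁⁻¹, ·)` this is print's (1.107); with `t̂ ↾ k` = the (o)-target and `Qfull k` = `log κ_k` it is the
H-line's top step. [cite: Balaban1985RegularSpaces, Prop. 5 (1.107)–(1.109) p.94, (1.113)–(1.117) pp.95–96, (1.91)–(1.92) p.91] -/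
theorem hFP_kLevel_family_RD (hL : 1 ≤ L) (hη : 0 < η) (hU₀ : ∀ x κ, U₀ x κ ∈ unitaryUnits 𝔸)
    (hEbΩ : ∀ j, j ≤ k → ∀ x ∈ Ω j, ∀ μ : Fin d, (x, μ) ∈ Eb j ∧ (x - e μ, μ) ∈ Eb j)
    (hEbT : ∀ j, j ≤ k → ∀ y ∈ Λs j, ∀ (x : Site d) (κ : Fin d), InBox (tlo L y j) (thi L y j) x →
      InBox (tlo L y j) (thi L y j) (x + e κ) → (x, κ) ∈ Eb j)
    -- letters of [4] (RD form)
    (g Δ : (Site d → 𝔸) →ₗ[ℂ] (Site d → 𝔸)) (q : (Site d → 𝔸) →ₗ[ℂ] (ℕ → Site d → 𝔸)) (qs : (ℕ → Site d → 𝔸) →ₗ[ℂ] (Site d → 𝔸))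
    (Aw c : (ℕ → Site d → 𝔸) →ₗ[ℂ] (ℕ → Site d → 𝔸))
    (g_rightΩ : ∀ x, ∀ y ∈ Ω 0, (Δ (g x) + qs (Aw (q (g x)))) y = x y)
    (c_range : ∀ f, q (g (g (qs (c (q f))))) = q f)
    (hΔ : ∀ (f : Site d → 𝔸), ∀ x ∈ Ω 0, Δ f x = covLap η U₀ ((Ω 0).indicator f) x)
    (hqs : ∀ (μ : ℕ → Site d → 𝔸), ∀ x ∈ Ω 0, qs μ x = QT L k Λs U₀ μ x)
    -- the letter H′ of (1.91)–(1.92)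
    (H' : XSpace d k 𝔸 →ₗ[ℂ] (Site d → 𝔸))
    {α₄ B₀' B₂' Cb Cl BG BR cA cDA : ℝ}
    (hα₄ : 0 < α₄) (hB : 0 < B₀') (hB₂ : 0 ≤ B₂') (hCb : 0 ≤ Cb) (hCl : 0 ≤ Cl)
    (hH0 : ∀ (X : XSpace d k 𝔸) (x : Site d), ‖H' X x‖ ≤ B₀' * ‖X‖)
    (hH1 : ∀ j, j ≤ k → ∀ (X : XSpace d k 𝔸), ∀ p ∈ Eb j, wt L η j * ‖covDerivFwd η U₀ p.2 (H' X) p.1‖ ≤ B₀' * ‖X‖)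
    (hH2 : ∀ X : XSpace d k 𝔸, Bd2 L η k Ω (covLap η U₀ (H' X)) (B₂' * ‖X‖))
    (hHsupp : ∀ (X : XSpace d k 𝔸) (x : Site d), x ∉ Ω 0 → H' X x = 0)
    (hHequiv : ∀ X Y : XSpace d k 𝔸, (∀ p, Y p = -star (X p)) → ∀ x, H' Y x = -star (H' X x))
    -- the abstract remainder family: (1.121), (1.125), reality on the (1.120)-set of every tower
    (Cfam : ℕ → (Site d → 𝔸) → Site d → 𝔸)
    (hC121 : ∀ j, j ≤ k → ∀ y ∈ Λs j, ∀ μ : Site d → 𝔸,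
      (∀ x : Site d, InBox (tlo L y j) (thi L y j) x → ‖μ x‖ < α₄) →
      (∀ (x : Site d) (κ : Fin d), InBox (tlo L y j) (thi L y j) x → InBox (tlo L y j) (thi L y j) (x + e κ) →
        ‖cj (U₀ x κ) (μ (x + e κ)) - μ x‖ < α₄ * ((L : ℝ) ^ j)⁻¹) →
      ‖Cfam j μ y‖ ≤ Cb)
    (hC125 : ∀ j, j ≤ k → ∀ y ∈ Λs j, ∀ (μ₁ μ₂ : Site d → 𝔸) (m : ℝ), 0 ≤ m →
      (∀ x : Site d, InBox (tlo L y j) (thi L y j) x → ‖μ₁ x‖ < α₄) →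
      (∀ (x : Site d) (κ : Fin d), InBox (tlo L y j) (thi L y j) x → InBox (tlo L y j) (thi L y j) (x + e κ) →
        ‖cj (U₀ x κ) (μ₁ (x + e κ)) - μ₁ x‖ < α₄ * ((L : ℝ) ^ j)⁻¹) →
      (∀ x : Site d, InBox (tlo L y j) (thi L y j) x → ‖μ₂ x‖ < α₄) →
      (∀ (x : Site d) (κ : Fin d), InBox (tlo L y j) (thi L y j) x → InBox (tlo L y j) (thi L y j) (x + e κ) →
        ‖cj (U₀ x κ) (μ₂ (x + e κ)) - μ₂ x‖ < α₄ * ((L : ℝ) ^ j)⁻¹) →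
      (∀ x : Site d, InBox (tlo L y j) (thi L y j) x → ‖(μ₁ - μ₂) x‖ ≤ m) →
      (∀ (x : Site d) (κ : Fin d), InBox (tlo L y j) (thi L y j) x → InBox (tlo L y j) (thi L y j) (x + e κ) →
        ‖cj (U₀ x κ) ((μ₁ - μ₂) (x + e κ)) - (μ₁ - μ₂) x‖ ≤ m * ((L : ℝ) ^ j)⁻¹) →
      ‖Cfam j μ₁ y - Cfam j μ₂ y‖ ≤ Cl * m)
    (hCreal : ∀ j, j ≤ k → ∀ y ∈ Λs j, ∀ μ : Site d → 𝔸,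
      (∀ x : Site d, InBox (tlo L y j) (thi L y j) x → ‖μ x‖ < α₄) →
      (∀ (x : Site d) (κ : Fin d), InBox (tlo L y j) (thi L y j) x → InBox (tlo L y j) (thi L y j) (x + e κ) →
        ‖cj (U₀ x κ) (μ (x + e κ)) - μ x‖ < α₄ * ((L : ℝ) ^ j)⁻¹) →
      Cfam j (fun x => -star (μ x)) y = -star (Cfam j μ y))
    (hCbρ : Cb ≤ α₄ / (2 * B₀')) (hClB : Cl * B₀' ≤ 1 / 2)
    -- the target: skew, `B′₀‖t̂‖ < ¼α₄`
    (th : XSpace d k 𝔸) (hτ : B₀' * ‖th‖ < α₄ / 4) (hth : ∀ p, star (th p) = -th p)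
    -- the split of the restriction functional: `Qfull = Qlin + Cfam`, `Qlin` additive with `Qlin (H′Y) = Y` and `Q′λ = 0 ⇒ Qlin (−iλ) = 0` on the index sites
    (Qfull Qlin : ℕ → (Site d → 𝔸) → Site d → 𝔸)
    (h213 : ∀ (j : ℕ), j ≤ k → ∀ y ∈ Λs j, ∀ μ : Site d → 𝔸, Qfull j μ y = Qlin j μ y + Cfam j μ y)
    (hlin : ∀ (j : ℕ) (μ₁ μ₂ : Site d → 𝔸) (y : Site d), Qlin j (μ₁ - μ₂) y = Qlin j μ₁ y - Qlin j μ₂ y)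
    (hQH : ∀ (Y : XSpace d k 𝔸) (j : ℕ) (hj : j ≤ k) (y : Site d), y ∈ Λs j → Qlin j (H' Y) y = Y (⟨j, Nat.lt_succ_of_le hj⟩, y))
    (hQlin0 : ∀ lam : Site d → 𝔸, q lam = 0 → ∀ (j : ℕ), j ≤ k → ∀ y ∈ Λs j, Qlin j ((-I) • lam) y = 0)
    -- JOIN-B's letters G′/R ((1.101), (1.98)R, range, reality), the datum, and its windows at the Sect. E sizes
    (hBG : 0 ≤ BG) (hBR : 0 ≤ BR) (hcA : 0 ≤ cA) (hcA' : cA ≤ 1 / 13) (hcDA : 0 ≤ cDA)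
    (ha₁' : α₄ / 4 + B₀' * (Cb + ‖th‖) ≤ 1 / 24) (hb₁' : α₄ / 4 + B₀' * (Cb + ‖th‖) ≤ 1 / 140)
    (hθ : 10 * (α₄ / 4 + B₀' * (Cb + ‖th‖)) * BR ≤ 1 / 2) (hh₀' : B₀' * (Cb + ‖th‖) ≤ 3 * α₄ / 4)
    (hG : ∀ (f : Site d → 𝔸) (m : ℝ), 0 ≤ m → Bd2 L η k Ω f m →
      (∀ x, ‖g f x‖ ≤ BG * m) ∧ ∀ j, j ≤ k → ∀ p ∈ Eb j, wt L η j * ‖covDerivFwd η U₀ p.2 (g f) p.1‖ ≤ BG * m)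
    (hGsupp : ∀ (f : Site d → 𝔸) (x : Site d), x ∉ Ω 0 → g f x = 0)
    (hGreal : ∀ f : Site d → 𝔸, (∀ j, j ≤ k → ∀ x ∈ Ω j, IsSelfAdjoint (f x)) → ∀ x, IsSelfAdjoint (g f x))
    (hRbd : ∀ (f : Site d → 𝔸) (m : ℝ), 0 ≤ m → Bd2 L η k Ω f m → Bd2 L η k Ω (f - g (qs (c (q (g f))))) (BR * m))
    (hRreal : ∀ f : Site d → 𝔸, (∀ j, j ≤ k → ∀ x ∈ Ω j, IsSelfAdjoint (f x)) →
      ∀ j, j ≤ k → ∀ x ∈ Ω j, IsSelfAdjoint ((f - g (qs (c (q (g f))))) x))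
    (hDA : Bd2 L η k Ω (fun y => covDivB η U₀ A y) cDA) (hDAsa : ∀ j, j ≤ k → ∀ x ∈ Ω j, IsSelfAdjoint (covDivB η U₀ A x))
    (hA : ∀ j, j ≤ k → ∀ x ∈ Ω j, ∀ μ : Fin d,
      wt L η j * ‖A x μ‖ ≤ cA ∧ wt L η j * ‖conjR (U₀ (x - e μ) μ)⁻¹ (A (x - e μ) μ)‖ ≤ cA)
    (hAsa : ∀ x μ, IsSelfAdjoint (A x μ))
    (h103 : BG * Mc d BR (α₄ / 4 + B₀' * (Cb + ‖th‖)) cA (B₂' * (Cb + ‖th‖)) cDA ≤ α₄ / 4)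
    (h106 : BG * Kc d BR (α₄ / 4 + B₀' * (Cb + ‖th‖)) cA (B₂' * (Cb + ‖th‖)) cDA (B₂' * (2 * Cl)) (1 + B₀' * (2 * Cl)) (1 + B₀' * (2 * Cl))
      ≤ 1 / 2) :
    ∃ lam : Site d → 𝔸, (∀ x, IsSelfAdjoint (lam x)) ∧ (∀ x, x ∉ Ω 0 → lam x = 0) ∧
      (∀ j, j ≤ k → ∀ p ∈ Eb j, ‖lam p.1‖ ≤ α₄ ∧ wt L η j * ‖covDerivFwd η U₀ p.2 lam p.1‖ ≤ α₄) ∧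
      (∃ μ : ℕ → Site d → 𝔸, ∀ x ∈ Ω 0,
        covLap η U₀ ((Ω 0).indicator fun y => covDivB η U₀ A y + covLap η U₀ lam y +
          ((conjR (gaugeExp lam y)⁻¹ (covDivB η U₀ A y) - covDivB η U₀ A y) +
            (gAd (covLap η U₀ lam y) (lam y) - covLap η U₀ lam y) + ∑ μ, frakF3 η U₀ lam A y μ)) x = QT L k Λs U₀ μ x) ∧
      ∀ (j : ℕ) (hj : j ≤ k) (y : Site d), y ∈ Λs j → Qfull j ((-I) • lam) y = th (⟨j, Nat.lt_succ_of_le hj⟩, y) := by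
  -- ★w8 s2's J4b: the Sect. E correction of the family with its eight binders and the transfer (1.117)
  obtain ⟨Hc, hc0, hc1, hc2, hcL0, hcL1, hcL2, hcsa, hcsupp, hT⟩ := exists_Hc_of_family (Ω := Ω) (Λs := Λs) (Eb := Eb) (U₀ := U₀)
    hL hη H' hα₄ hB hB₂ hCb hCl hEbT hH0 hH1 hH2 hHsupp hHequiv hC121 hC125 hCreal hCbρ hClB th hτ hth
  have hh₀ : 0 ≤ B₀' * (Cb + ‖th‖) := mul_nonneg hB.le (add_nonneg hCb (norm_nonneg _))
  have hh₂ : 0 ≤ B₂' * (Cb + ‖th‖) := mul_nonneg hB₂ (add_nonneg hCb (norm_nonneg _))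
  have hl₀ : 0 ≤ B₀' * (2 * Cl) := by positivity
  have hl₂ : 0 ≤ B₂' * (2 * Cl) := by positivity
  have hb₁ : 0 < α₄ / 4 + B₀' * (Cb + ‖th‖) := by positivity
  -- the restriction-agnostic JOIN-B at `P := Qfull (−iλ′) = t̂ on 𝔅_k`
  refine hFP_kLevel_ofConstraint_RD hL hη hU₀ hEbΩ g Δ q qs Aw c g_rightΩ c_range hΔ hqs Hc hα₄ hBG hBR hh₀ hh₂ hl₀ hl₀ hl₂ hcA hcA' hcDA ha₁' hb₁'
    hb₁ hθ hh₀' hh₀' hG hGsupp hGreal hRbd hRreal hc0 hc1 hc2 hcL0 hcL1 hcL2 hcsa hcsupp hDA hDAsa hA hAsa h103 h106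
    (fun lam => ∀ (j : ℕ) (hj : j ≤ k) (y : Site d), y ∈ Λs j → Qfull j ((-I) • lam) y = th (⟨j, Nat.lt_succ_of_le hj⟩, y)) ?_
  -- the transfer: (1.117) for the family ⇒ (1.114) with the shifted base point ⇒ `Qfull (−iλ′) = Qlin (−iλ_s) + t̂ = t̂`
  intro s hs hq j hj y hy
  obtain ⟨X, -, -, -, hfix, -, hlamE⟩ := hT s hs
  rw [hlamE]
  have h114 := eq1114_of_fixedPoint_kLevel_fam (Λ := Λs) (H' := H') (lam := (-I) • lamOf s + H' th) (Cfam := Cfam) Qfull Qlin h213 hlin hQH hfix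
    j hj y hy
  rw [h114, qlin_add_of_sub Qlin hlin, hQH th j hj y hy, hQlin0 (lamOf s) hq j hj y hy, zero_add]

end Summit.QuantumFields.YangMills.Theorems.HalvingP1FlatCoreTopStep

end
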